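import Literature.Geometry.Lorentzian.TameFarFrame
import Literature.Geometry.Lorentzian.LeafAdaptedModelChartsMinkowski
import HarnessLib

/-!
# Stub `stub_minkowskiTameFarFrame` (sanity) of line `far-tail-peeling-one-leaf` of crux `Capture`
# (stmt-FinalStateConjecture-10115): ANTI-VACUITY OF THE TAME FAR FRAME WITH TAIL — Minkowski
# space carries one of every order

The line `far-tail-peeling-one-leaf` of the crux `Capture` (routes `BartnikGapSettling` /
`QuietWindowCapture`, summit `FinalStateConjecture`) feeds its engine (`stub_engine`) with a TAME FAR
FRAME WITH TAIL `IsTameFarFrameWithTail 𝒟 k n c Rt C T₀ lam om U Φ`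
(`Literature/Geometry/Lorentzian/TameFarFrame.lean`): `n ≥ 1` continuous, mutually receding centre
curves, a tube radius `Rt > 0`, one far chart `Φ` on `U ⊇ farZone`, `Cᵏ` sup bounds
`≤ C/s + λ(T)` of the deviation `Φ^* g − η` on the dyadic shells of the late slabs, and incoming-
derivative bounds `≤ (ω(s) + λ(T))/s + C s / Dᵢ(T)` on the dyadic shells of the Voronoi cells.
This file proves the registered sanity stub `stub_minkowskiTameFarFrame` (verbatim signature): the
Minkowski development `Minkowski.vacuumCauchyDevelopment` of the trivial datum `(ℝ³, δ, 0)` carries,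
for EVERY order `k`, a tame far frame with tail with ONE virtual centre at rest at the origin
(`c = 0`), tube radius `1`, `C = 0`, `T₀ = 0`, slack `λ = 0`, modulus `ω = 0`, on `U = ⊤` with the
identity chart `Φ y = y`.

Clause by clause: `0 < 1`; the centre is continuous (constant); the recession clause
`∀ i ≠ j, …` is vacuous on `Fin 1`; `λ = ω = 0 → 0`; `farZone ⊆ ⊤`; the identity chart is smooth
(Mathlib `contMDiff_subtype_val`) and its restriction to the (open) far zone is an open embedding
(two inclusions of open subsets); the far zone `{x⁰ > 0, |x̲| > 1}` is charted into
`J⁺({x⁰ = 0}) ⊇ {x⁰ ≥ 0}` (solid cones, `Minkowski.mem_causalFuture_vacuumCauchyDevelopment`); the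
far deviation `ι^* η − η` VANISHES IDENTICALLY (tree:
`Minkowski.deviationExtend_vacuumCauchyDevelopment_subtypeVal`), so every dyadic-shell `Cᵏ` sup norm
is `0` (`supCkENorm_zero`), and so does the incoming-derivative field
`D(w · 0)(x)[L(x)] = 0` (`fderiv` of a constant), whence the tail bound.

No named facts are used and no definitions are introduced.  References: Hawking–Ellis 1973, §5.1
(Minkowski space); O'Neill 1983, Ch. 14, p. 402 (causality of `ℝ⁴₁`); Christodoulou–Klainerman
1993, Thm. 1.0.2 and Ch. 17 (Minkowski space is its own final state; the far wave zone);
Dafermos–Holzegel–Rodnianski–Taylor arXiv:2104.08222, §1 (the deviation vocabulary).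
-/

-- the doubled `FinalStateConjecture.FinalStateConjecture` path component trips dupNamespace
set_option linter.dupNamespace false

noncomputable section

namespace Summit.FinalStateConjecture.FinalStateConjecture.Theorems.BartnikGapSettling.Capture

open Set Filter Function Topology TopologicalSpace
open scoped Manifold ContDiff ENNReal
open Literature.Geometry.Lorentzian

/-! ### §1 Far-frame geometry: the far zone is open -/

/-- The distance `x ↦ |x̲ − c(x⁰)|` to a continuous centre curve is continuous. [folklore] -/
private theorem continuous_centreDist {c : ℝ → E3} (hc : Continuous c) :
    Continuous (centreDist c) := by
  unfold centreDist
  fun_prop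

/-- The far zone `{x⁰ > T₀, |x̲ − cᵢ(x⁰)| > Rt ∀ i}` of finitely many continuous centre curves is
open. [folklore] -/
private theorem isOpen_farZone {n : ℕ} {c : Fin n → ℝ → E3} (hc : ∀ i, Continuous (c i))
    (Rt T₀ : ℝ) : IsOpen (farZone c Rt T₀) := by
  have h0 : Continuous fun x : E4 => x 0 := by fun_prop
  refine (isOpen_lt continuous_const h0).and ?_
  rw [setOf_forall]
  exact isOpen_iInter_of_finite fun i => isOpen_lt continuous_const (continuous_centreDist (hc i))

/-! ### §2 The identity chart of the Minkowski development -/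

/-- `{x⁰ ≥ 0} ⊆ J⁺(ι ℝ³)` in the Minkowski development: `x` lies vertically above the slice point
`(0, x̲)` (`Minkowski.causalFuture_singleton`). O'Neill 1983, Ch. 14, p. 402. [folklore] -/
private theorem mem_causalFuture_range_embed' {x : E4} (hx : 0 ≤ x 0) :
    x ∈ Minkowski.vacuumCauchyDevelopment.metric.causalFuture
      Minkowski.vacuumCauchyDevelopment.timeOrientation
      (range Minkowski.vacuumCauchyDevelopment.embed) := by
  have hJ : x ∈ Minkowski.vacuumCauchyDevelopment.metric.causalFuture
      Minkowski.vacuumCauchyDevelopment.timeOrientation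
      ({E4.ofTimeSpace 0 (E4.spatial x)} : Set E4) := by
    refine Minkowski.mem_causalFuture_vacuumCauchyDevelopment ?_
    simp only [E4.spatial_ofTimeSpace, sub_self, norm_zero, E4.ofTimeSpace_apply_zero, sub_zero]
    exact hx
  refine LorentzianMetric.causalFuture_mono (M := Minkowski.vacuumCauchyDevelopment.carrier) ?_ hJ
  exact singleton_subset_iff.mpr ⟨⟨E4.spatial x, trivial⟩, rfl⟩

/-- The identity chart of the Minkowski development is an exact isometry of `η`: its far deviation
(`ι^* η − η` extended by `0`) vanishes identically (tree:
`Minkowski.deviationExtend_vacuumCauchyDevelopment_subtypeVal`). Christodoulou–Klainerman 1993,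
Thm. 1.0.2. [folklore] -/
private theorem farDeviation_id :
    farDeviation Minkowski.vacuumCauchyDevelopment.toCauchyDevelopment ⊤
      (fun y : (⊤ : Opens E4) => (y.1 : Minkowski.vacuumCauchyDevelopment.carrier)) = 0 :=
  Minkowski.deviationExtend_vacuumCauchyDevelopment_subtypeVal

/-- Hence the incoming-derivative field `x ↦ D(wᶜ · (ι^* η − η))(x)[L(x)]` of every centre `c`
vanishes identically in the identity chart (the derivative of the zero function).
Christodoulou–Klainerman 1993, Ch. 17 (no incoming radiation in Minkowski space). [folklore] -/
private theorem incomingDeriv_id (c : ℝ → E3) :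
    incomingDeriv Minkowski.vacuumCauchyDevelopment.toCauchyDevelopment c ⊤
      (fun y : (⊤ : Opens E4) => (y.1 : Minkowski.vacuumCauchyDevelopment.carrier)) = 0 := by
  have h0 : (fun y : E4 => centreDist c y •
      farDeviation Minkowski.vacuumCauchyDevelopment.toCauchyDevelopment ⊤
        (fun y : (⊤ : Opens E4) => (y.1 : Minkowski.vacuumCauchyDevelopment.carrier)) y) =
      fun _ => 0 := by
    funext y
    rw [farDeviation_id, Pi.zero_apply]
    -- `SMulZeroClass ℝ (E4 →L[ℝ] E4 →L[ℝ] ℝ)` is not found by instance search, so `smul_zero`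
    -- does not fire; go pointwise
    ext v w
    simp
  funext x
  rw [incomingDeriv_apply, h0, fderiv_fun_const]
  rfl

/-! ### §3 The stub -/

/-- **Sanity stub (ANTI-VACUITY OF THE FAR FRAME WITH TAIL)** (stub `stub_minkowskiTameFarFrame` of
line `far-tail-peeling-one-leaf`, crux `Capture`, stmt-FinalStateConjecture-10115): the Minkowski
development carries, for every order `k`, a tame far frame with tail with ONE virtual centre at rest
at the origin, tube radius `1`, `C = 0`, `T₀ = 0`, slack `λ = 0`, modulus `ω = 0`, on `U = ⊤` with
the identity chart (zero deviation, zero incoming derivative; recession and companion terms are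
vacuous for `n = 1`). [cite: HawkingEllis1973, §5.1] -/
theorem stub_minkowskiTameFarFrame :
    ∀ k : ℕ, IsTameFarFrameWithTail Minkowski.vacuumCauchyDevelopment.toCauchyDevelopment k 1
      (fun _ _ => (0 : E3)) 1 0 0 (fun _ => 0) (fun _ => 0) ⊤
      (fun y : (⊤ : Opens E4) => (y.1 : Minkowski.vacuumCauchyDevelopment.carrier)) := by
  intro k
  have hc : ∀ _i : Fin 1, Continuous (fun _ : ℝ => (0 : E3)) := fun _ => continuous_const
  have hopen : IsOpen (farZone (fun (_ : Fin 1) (_ : ℝ) => (0 : E3)) 1 0) := isOpen_farZone hc 1 0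
  refine ⟨⟨Nat.one_pos, one_pos, hc, fun i j h => absurd (Subsingleton.elim i j) h,
    tendsto_const_nhds, fun _ _ => trivial, ?_, ?_, ?_, ?_⟩, tendsto_const_nhds, ?_⟩
  · -- the identity chart is smooth (on the far zone)
    exact contMDiff_subtype_val.contMDiffOn
  · -- its restriction to the open far zone is an open embedding
    exact (IsOpen.isOpenEmbedding_subtypeVal (⊤ : Opens E4).isOpen).comp
      (IsOpen.isOpenEmbedding_subtypeVal (hopen.preimage continuous_subtype_val))
  · -- the far zone `{x⁰ > 0, |x̲| > 1}` is charted into `J⁺(ι ℝ³) ⊇ {x⁰ ≥ 0}`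
    rintro _ ⟨y, hy, rfl⟩
    exact mem_causalFuture_range_embed' (le_of_lt hy.1)
  · -- the dyadic-shell bound: the far deviation vanishes identically
    intro T s _ _
    rw [farDeviation_id, supCkENorm_zero]
    exact zero_le
  · -- the incoming-tail bound: the incoming-derivative field vanishes identically
    intro i T s _ _
    rw [incomingDeriv_id, supCkENorm_zero]
    exact zero_le

end Summit.FinalStateConjecture.FinalStateConjecture.Theorems.BartnikGapSettling.Capture

end
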